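import Summits.ResolutionOfSingularities.ResolutionOfSingularities.Theorems.SplitTowerQuot

/-!
# SplitTower (T5/·) — THE GENERIC POINT: `NotPow` over the fraction field of `𝒪_x/𝔓`

Node «SplitTower» of `decomp-res-lens-2` (g34), see `Theorems/MaxContactCutSplitTower.lean`.

* §N  `notPow_frac` — over `K = Frac D`, `D` an integrally closed local domain, the vertex coefficients `g` of a split
  cone are NOT a binomial power `(C(n,i) γ^i)_i`, granted the MIDDLE COEFFICIENT (`g_j = u p^e`, `u` a unit, `e ≤ j`,
  `p` a uniformiser `𝔪_D = (p)` or a unit), the VERTEX TAMENESS (`g_n ∈ 𝔪_D` or a middle `g_{j'}` is a unit) and the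
  BINOMIAL GUARD (`C(n,i) ∈ 𝔪_D`, `0 < i < n`).  If `n = 0` in `K` the guard kills `C(n,j)` in `K` while `g_j ≠ 0`;
  else `γ = g₁/n ∈ K`, `γⁿ = g_n` makes `γ ∈ D` (integrally closed), and `g_j = C(n,j)γ^j ∈ 𝔪_D^{j+1}` resp. the
  unit `g_n = γⁿ` contradict the middle coefficient resp. the vertex tameness.  NO valuation extension is used.
* §G  `SplitShape.notPow_quot` — for a split shape the vertex coefficients modulo the curve prime `𝔓 = (c)` are `NotPow`
  over `Frac(A/𝔓)` (§N: `A/𝔓` is regular, hence an integrally closed local domain).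

Sources: [Matsumura1987] Thms. 14.2, 19.4; [Hironaka1964] Ch. III §3; [CossartJannsenSaito2020] Ch. 2.
-/

open IsLocalRing
open Literature.AlgebraicGeometry.Resolution
open Summit.ResolutionOfSingularities.ResolutionOfSingularities.Theorems.SplitCut (splitCone MiddleCoeff VertexTame)
open Summit.ResolutionOfSingularities.ResolutionOfSingularities.Theorems.JetCut (WtIdeal)
open Summit.ResolutionOfSingularities.ResolutionOfSingularities.Theorems.PurityCut (BinomGuard)

namespace Summit.ResolutionOfSingularities.ResolutionOfSingularities.Theorems.SplitTower

/-! ## §N  `NotPow` over the fraction field of an integrally closed local domain -/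

section Frac

variable {D K : Type} [CommRing D] [IsDomain D] [IsLocalRing D] [IsIntegrallyClosed D] [Field K] [Algebra D K]
  [IsFractionRing D K]

/-- **THE VERTEX COEFFICIENTS ARE NOT A BINOMIAL POWER over `Frac D`** (middle coefficient + vertex tameness + binomial
guard, `D` an integrally closed local domain). [folklore] -/
theorem notPow_frac {n : ℕ} (hn : 2 ≤ n) (g : ℕ → D)
    (hmid : ∃ (j e : ℕ) (u p : D), 0 < j ∧ j < n ∧ e ≤ j ∧ IsUnit u ∧ g j = u * p ^ e ∧
      ((maximalIdeal D = Ideal.span {p} ∧ p ≠ 0) ∨ IsUnit p))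
    (hvtx : g n ∈ maximalIdeal D ∨ ∃ j, 0 < j ∧ j < n ∧ IsUnit (g j))
    (hguard : ∀ i, 0 < i → i < n → ((n.choose i : ℕ) : D) ∈ maximalIdeal D) :
    NotPow K n (fun i => algebraMap D K (g i)) := by
  classical
  obtain ⟨j, e, u, p, hj0, hjn, hej, hu, hgj, hp⟩ := hmid
  have hinj : Function.Injective (algebraMap D K) := IsFractionRing.injective D K
  have hgj0 : g j ≠ 0 := by
    rw [hgj]
    refine mul_ne_zero hu.ne_zero (pow_ne_zero _ ?_)
    rcases hp with ⟨-, hp0⟩ | hpu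
    · exact hp0
    · exact hpu.ne_zero
  by_cases hnK : ((n : ℕ) : K) = 0
  · -- `n = 0` in `K`: the characteristic `q` is a prime dividing `n`, and the guard kills `C(n,j)` in `κ(D)`, so in `K`
    have hnD : ((n : ℕ) : D) = 0 := hinj (by rw [map_natCast, map_zero]; exact hnK)
    obtain ⟨q, hq⟩ := CharP.exists D
    have hqn : q ∣ n := (CharP.cast_eq_zero_iff D q n).mp hnD
    have hq0 : q ≠ 0 := by rintro rfl; rw [zero_dvd_iff] at hqn; omega
    have hqprime : q.Prime := (CharP.char_is_prime_or_zero D q).resolve_right hq0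
    haveI : CharP (ResidueField D) q := (CharP.charP_iff_prime_eq_zero hqprime).mpr (by
      have h : residue D (q : D) = 0 := by rw [CharP.cast_eq_zero, map_zero]
      rwa [map_natCast] at h)
    haveI : CharP K q := (CharP.charP_iff_prime_eq_zero hqprime).mpr (by
      have h : algebraMap D K (q : D) = 0 := by rw [CharP.cast_eq_zero, map_zero]
      rwa [map_natCast] at h)
    have hc : ((n.choose j : ℕ) : K) = 0 := by
      rw [CharP.cast_eq_zero_iff K q, ← CharP.cast_eq_zero_iff (ResidueField D) q]
      have h := (residue_eq_zero_iff _).mpr (hguard j hj0 hjn)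
      rwa [map_natCast] at h
    exact notPow_of_choose_eq_zero hjn.le ((map_ne_zero_iff _ hinj).mpr hgj0) hc
  · -- `n ≠ 0` in `K`: `γ = g₁/n ∈ K`, `γⁿ = g_n`, so `γ ∈ D`
    intro F _ f γ hγ
    have hfinj : Function.Injective f := f.injective
    have hnF : ((n : ℕ) : F) ≠ 0 := fun h => hnK (hfinj (by rw [map_natCast, map_zero, h]))
    set γ₀ : K := algebraMap D K (g 1) / (n : K) with hγ₀
    have h1 := hγ 1 (by omega)
    rw [Nat.choose_one_right, pow_one] at h1
    have hγf : f γ₀ = γ := by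
      rw [hγ₀, map_div₀, map_natCast, h1]
      exact mul_div_cancel_left₀ γ hnF
    have hK : ∀ i ≤ n, algebraMap D K (g i) = (n.choose i : K) * γ₀ ^ i := fun i hi =>
      hfinj (by rw [map_mul, map_natCast, map_pow, hγf]; exact hγ i hi)
    have hKn : γ₀ ^ n = algebraMap D K (g n) := by
      rw [hK n le_rfl, Nat.choose_self, Nat.cast_one, one_mul]
    obtain ⟨d, hd⟩ := IsIntegrallyClosed.exists_algebraMap_eq_of_isIntegral_pow (R := D) (show 0 < n by omega)
      (by rw [hKn]; exact isIntegral_algebraMap)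
    have hD : ∀ i ≤ n, g i = (n.choose i : D) * d ^ i := fun i hi =>
      hinj (by rw [map_mul, map_natCast, map_pow, hd]; exact hK i hi)
    by_cases hdm : d ∈ maximalIdeal D
    · -- `d ∈ 𝔪_D`: `g_j = C(n,j) d^j ∈ 𝔪_D · 𝔪_D^j` against `g_j = u p^e`, `e ≤ j`
      have hgjm : g j ∈ maximalIdeal D := by
        rw [hD j hjn.le]; exact Ideal.mul_mem_right _ _ (hguard j hj0 hjn)
      rcases hp with ⟨hmp, hp0⟩ | hpu
      · have hmem : g j ∈ Ideal.span {p ^ (e + 1)} := by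
          have h2 : g j ∈ maximalIdeal D ^ (j + 1) := by
            rw [hD j hjn.le, pow_succ']
            exact Ideal.mul_mem_mul (hguard j hj0 hjn) (Ideal.pow_mem_pow hdm j)
          rw [hmp, Ideal.span_singleton_pow] at h2
          exact Ideal.span_singleton_le_span_singleton.mpr (pow_dvd_pow p (by omega)) h2
        obtain ⟨r, hr⟩ := Ideal.mem_span_singleton'.mp hmem
        have hu' : u = r * p := by
          have h0 : p ^ e * (u - r * p) = 0 := by
            have h3 : r * p ^ (e + 1) = u * p ^ e := hr.trans hgj
            linear_combination -h3
          rcases mul_eq_zero.mp h0 with h | h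
          · exact absurd (pow_eq_zero_iff'.mp h).1 hp0
          · exact sub_eq_zero.mp h
        have hum : u ∈ maximalIdeal D := by
          rw [hu', hmp]; exact Ideal.mul_mem_left _ _ (Ideal.mem_span_singleton_self p)
        exact (mem_maximalIdeal _).mp hum hu
      · exact (mem_maximalIdeal _).mp hgjm (by rw [hgj]; exact hu.mul (hpu.pow e))
    · -- `d` a unit: `g_n = dⁿ` is a unit, against the vertex tameness and the guard
      have hdu : IsUnit d := IsLocalRing.notMem_maximalIdeal.mp hdm
      rcases hvtx with hgn | ⟨j', hj'0, hj'n, hunit⟩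
      · have h : g n = d ^ n := by rw [hD n le_rfl, Nat.choose_self, Nat.cast_one, one_mul]
        exact (mem_maximalIdeal _).mp hgn (h ▸ hdu.pow n)
      · have h : g j' ∈ maximalIdeal D := by
          rw [hD j' hj'n.le]; exact Ideal.mul_mem_right _ _ (hguard j' hj'0 hj'n)
        exact (mem_maximalIdeal _).mp h hunit

end Frac

/-! ## §G  The vertex coefficients of a split shape modulo the curve prime -/

section Generic

variable {A : Type} [CommRing A] [IsLocalRing A]

variable {J P : Ideal A} {n k : ℕ}

/-- The quotient `A/𝔓` of the ring of a split shape by its curve prime is a regular local ring (of dimension one).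
[cite: Matsumura1987, Thm. 14.2] -/
theorem SplitShape.isRegularLocalRing_quot (D : SplitShape J P n k) : IsRegularLocalRing (A ⧸ P) := by
  haveI := D.isRegularLocalRing
  rw [← D.span_c]
  exact D.rsop.isRegularLocalRing_quotient

/-- **THE VERTEX COEFFICIENTS MODULO THE CURVE PRIME ARE `NotPow` OVER `Frac(A/𝔓)`** (§N applied to `A/𝔓`, a regular —
hence integrally closed — local domain, with the middle coefficient, vertex tameness and binomial guard of the shape).
[this node] -/
theorem SplitShape.notPow_quot (D : SplitShape J P n k) (hn : 2 ≤ n) {K : Type} [Field K] [Algebra (A ⧸ P) K]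
    [IsFractionRing (A ⧸ P) K] : NotPow K n (fun i => algebraMap (A ⧸ P) K (Ideal.Quotient.mk P (D.G i))) := by
  classical
  haveI : IsRegularLocalRing (A ⧸ P) := D.isRegularLocalRing_quot
  haveI : IsDomain (A ⧸ P) := isDomain_of_isRegularLocalRing _
  haveI : IsIntegrallyClosed (A ⧸ P) := isIntegrallyClosed_of_isRegularLocalRing _
  have hlocmk : ∀ x, Ideal.Quotient.mk P x ∈ maximalIdeal (A ⧸ P) ↔ x ∈ maximalIdeal A := fun x => by
    have h := PinchTower.mk_mem_pow_maximalIdeal_iff P x 1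
    rwa [pow_one, pow_one, sup_eq_right.mpr D.le_maximalIdeal] at h
  have hq : ∀ i, D.c i ∈ P := fun i => D.span_c.le (Ideal.subset_span ⟨i, rfl⟩)
  have hmid : ∃ (j e : ℕ) (u p : A ⧸ P), 0 < j ∧ j < n ∧ e ≤ j ∧ IsUnit u ∧
      Ideal.Quotient.mk P (D.G j) = u * p ^ e ∧ ((maximalIdeal (A ⧸ P) = Ideal.span {p} ∧ p ≠ 0) ∨ IsUnit p) := by
    obtain ⟨j, e, u, hj0, hjn, hej, hu, hGj, hϖ⟩ := D.mid
    refine ⟨j, e, Ideal.Quotient.mk P u, Ideal.Quotient.mk P D.ϖ, hj0, hjn, hej, hu.map _,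
      by rw [hGj, map_mul, map_pow], ?_⟩
    rcases hϖ with hspan | hunit
    · left
      have hϖP : D.ϖ ∉ P := fun hϖP => D.w_not_mem (by
        have hle : maximalIdeal A ≤ P := by
          rw [← hspan, Ideal.span_le]
          rintro x (⟨i, rfl⟩ | hx)
          · exact hq i
          · rw [Set.mem_singleton_iff.mp hx]; exact hϖP
        exact hle (D.span_cw.le (Ideal.subset_span (Or.inr rfl))))
      refine ⟨?_, fun h0 => hϖP (Ideal.Quotient.eq_zero_iff_mem.mp h0)⟩
      have h1 : (maximalIdeal A).map (Ideal.Quotient.mk P) = Ideal.span {Ideal.Quotient.mk P D.ϖ} := by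
        rw [← hspan, Ideal.span_union, Ideal.map_sup, D.span_c, Ideal.map_quotient_self, bot_sup_eq, Ideal.map_span,
          Set.image_singleton]
      rw [← h1, PinchTower.map_mk_maximalIdeal_eq]
    · exact Or.inr (hunit.map _)
  have hvtx : Ideal.Quotient.mk P (D.G n) ∈ maximalIdeal (A ⧸ P) ∨
      ∃ j, 0 < j ∧ j < n ∧ IsUnit (Ideal.Quotient.mk P (D.G j)) := by
    rcases D.vtx with h | ⟨j, hj0, hjn, hu⟩
    · exact Or.inl ((hlocmk _).mpr h)
    · exact Or.inr ⟨j, hj0, hjn, hu.map _⟩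
  have hguard : ∀ i, 0 < i → i < n → ((n.choose i : ℕ) : A ⧸ P) ∈ maximalIdeal (A ⧸ P) := fun i hi hin => by
    rw [← map_natCast (Ideal.Quotient.mk P), hlocmk]; exact D.guard i hi hin
  exact notPow_frac (K := K) hn (fun i => Ideal.Quotient.mk P (D.G i)) hmid hvtx hguard

end Generic

end Summit.ResolutionOfSingularities.ResolutionOfSingularities.Theorems.SplitTower
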